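import Summits.AtomisticToContinuum.FouriersLaw.Theorems.BondHeatUncertaintyExtensiveSnapshotIrreversibilityEnergyWindowScoreOrderOneA

/-!
# ScoreOrderLadder part V — the order-1 junction (MC∞) ∧ (RW₁) ⟹ (SD₁) and the headline — part 2 of 2 (sequel of `…BondHeatUncertaintyExtensiveSnapshotIrreversibilityEnergyWindowScoreOrderOneA`)

Split for the 400-line cap by the landing lane (hand-2 g33); the module docstring of part 1 (`…BondHeatUncertaintyExtensiveSnapshotIrreversibilityEnergyWindowScoreOrderOneA`) describes the whole node.  Same namespace; all FQNs unchanged.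
0 sorry; standard axioms.
-/

noncomputable section

namespace Summit.AtomisticToContinuum.FouriersLaw.Theorems.ExtensiveSnapshotIrreversibility.EnergyWindow

open MeasureTheory Filter Topology Set Metric
open scoped ENNReal NNReal Matrix ContDiff
open Literature.MathematicalPhysics.KineticTheory.HeatConduction Literature.Probability.Process

/-! ## 2. The order-1 junction -/

/-- ★★ **(MC∞) ∧ (RW₁) ⟹ (SD₁)** — the order-1 junction (module docstring §2). [folklore] -/
theorem densityScoreDualBoundFirst_of_gram (h₁ : SkeletonGramLimitInverseMoments)
    (h₂ : GramControlledWeightMoments) : DensityScoreDualBoundFirst := by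
  intro ω₂ lam β γ hω hl hβ hγ T hT N hN r ε hr hε
  have hN0 : 0 < N := by omega
  have hr0 : 0 < r := one_pos.trans hr
  -- the conjugate exponent
  set q : ℝ := r / (r - 1) with hq
  have hq1 : 1 < q := by
    rw [hq, one_lt_div (sub_pos.2 hr)]; linarith
  have hpq : r.HolderConjugate q :=
    Real.holderConjugate_iff.2 ⟨hr, by rw [hq]; field_simp [(sub_pos.2 hr).ne']; ring⟩
  -- the constants of (RW₁) and of (MC⁰_κ) ⟸ (MC∞)
  obtain ⟨q', ε', δR, K, μ, hq', hε', hδR, hK, hRW⟩ :=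
    h₂ ω₂ lam β γ hω hl hβ hγ T hT N hN q ε hq1 hε
  obtain ⟨δM, C, hδM, hC, hMC⟩ := skeletonGramInverseMomentsRegBody_of_limit hω hl.le hβ.le hγ.le
    (h₁ ω₂ lam β γ hω hl hβ hγ) T hT N hN q' ε' hq' hε'
  refine ⟨min (min δR δM) T, K * (1 + C) ^ μ, lt_min (lt_min hδR hδM) hT, by positivity,
    fun δ hδ p hp s hs hs1 b hb z G hG hGc i hi => ?_⟩
  have hδR' : |δ| < δR := hδ.trans_le ((min_le_left _ _).trans (min_le_left _ _))
  have hδM' : |δ| < δM := hδ.trans_le ((min_le_left _ _).trans (min_le_right _ _))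
  have hδT : |δ| < T := hδ.trans_le (min_le_right _ _)
  rw [abs_lt] at hδT
  have hTL0 : 0 < T + δ / 2 := by linarith
  have hTR0 : 0 < T - δ / 2 := by linarith
  have hs0 : 0 < s := by linarith
  have hs' : s ∈ Icc (0 : ℝ) 1 := ⟨hs0.le, hs1⟩
  have hG1 : ContDiff ℝ 1 G := hG.of_le (by exact_mod_cast le_top)
  set H : PhaseSpace N → ℝ := (pinnedChain ω₂ lam β γ).hamiltonian N with hH
  -- the two factors as functions of the starting point
  have hA₁0 : ∀ x : PhaseSpace N, 0 ≤ (∫ y, |G y| ^ r * p s x y) ^ (1 / r) := fun x =>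
    Real.rpow_nonneg (integral_nonneg fun y => mul_nonneg (Real.rpow_nonneg (abs_nonneg _) _)
      (hp.2.1 s hs0 x y)) _
  have hA₂0 : ∀ x : PhaseSpace N, 0 ≤ K * (1 + C) ^ μ * Real.exp (ε * H x) := fun x => by
    positivity
  have h1 : ∀ (x : PhaseSpace N) (m : ℕ), ∫⁻ wp, ENNReal.ofReal |G (skelFlowMapAt ω₂ lam β γ N
      (T + δ / 2) (T - δ / 2) s m x (pairRem m wp) (pairSkel m wp))| ^ r ∂wienerPair ≤
      ENNReal.ofReal (((∫ y, |G y| ^ r * p s x y) ^ (1 / r)) ^ r) := fun x m =>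
    (lintegral_rpow_abs_comp_eq hω hl hβ hγ N T δ hp hs0 hs1 hG.continuous hGc hr0 m x).le
  have h2 : ∀ x : PhaseSpace N, ∀ κ : ℝ, 0 < κ → ∃ m₁ : ℕ, ∀ m : ℕ, m₁ ≤ m →
      skelMoment m q (skelWeightArr ω₂ lam β γ N (T + δ / 2) (T - δ / 2) s m κ b x) ≤
          ENNReal.ofReal ((K * (1 + C) ^ μ * Real.exp (ε * H x)) ^ q) ∧
        skelMoment m q (skelWeightDep ω₂ lam β γ N (T + δ / 2) (T - δ / 2) s m κ b x) ≤
          ENNReal.ofReal ((K * (1 + C) ^ μ * Real.exp (ε * H x)) ^ q) := by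
    intro x κ hκ
    obtain ⟨m₁, Λ, hΛm, hframe, hinv⟩ := hMC δ hδM' s hs hs1 x κ hκ
    exact ⟨m₁, fun m hm => hRW C hC δ hδR' s hs hs1 b hb x κ hκ m Λ hΛm (hframe m hm) hinv⟩
  have hsurj : ∀ (x : PhaseSpace N) (wp : WienerPair), ∃ m₀ : ℕ, ∀ m, m₀ ≤ m → LinearMap.range
      (fderiv ℝ (skelFlowMapAt ω₂ lam β γ N (T + δ / 2) (T - δ / 2) s m x (pairRem m wp))
        (pairSkel m wp) : PairSkeleton m →ₗ[ℝ] PhaseSpace N) = ⊤ := fun x wp =>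
    skeletonEventualSurjectivity ω₂ lam β γ hω hl hβ hγ N hN0 _ _ hTL0 hTR0 s hs0 hs1 x wp
  -- the per-point ARRIVAL and DEPARTURE bounds of the tree (W-3, W-5)
  have hArr : ∀ (x : PhaseSpace N) (m : ℕ), |∫ wp, partialP b G (skelFlowMapAt ω₂ lam β γ N
      (T + δ / 2) (T - δ / 2) s m x (pairRem m wp) (pairSkel m wp)) ∂wienerPair| ≤
      (∫ y, |G y| ^ r * p s x y) ^ (1 / r) * (K * (1 + C) ^ μ * Real.exp (ε * H x)) :=
    fun x m => abs_integral_partialP_comp_le hω hl hβ hγ hN0 hT (T_L := T + δ / 2)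
      (T_R := T - δ / 2) (by linarith) (by linarith) (by linarith) (by linarith)
      skeletonSecondVariationMoments hpq hs' b x (hsurj x) hG1 hGc (hA₁0 x) (hA₂0 x) (h1 x)
      (fun κ hκ => by
        obtain ⟨m₁, hm₁⟩ := h2 x κ hκ
        exact ⟨m₁, fun m hm => (hm₁ m hm).1⟩) m
  have hDep : ∀ (x : PhaseSpace N) (m : ℕ), |∫ wp, partialP b (fun z' => G (skelFlowMapAt ω₂ lam β γ
      N (T + δ / 2) (T - δ / 2) s m z' (pairRem m wp) (pairSkel m wp))) x ∂wienerPair| ≤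
      (∫ y, |G y| ^ r * p s x y) ^ (1 / r) * (K * (1 + C) ^ μ * Real.exp (ε * H x)) :=
    fun x m => abs_integral_partialP_dep_le hω hl hβ hγ hN0 hT (T_L := T + δ / 2)
      (T_R := T - δ / 2) (by linarith) (by linarith) (by linarith) (by linarith)
      hpq hs' b x (hsurj x) hG1 hGc (hA₁0 x) (hA₂0 x) (h1 x)
      (fun κ hκ => by
        obtain ⟨m₁, hm₁⟩ := h2 x κ hκ
        exact ⟨m₁, fun m hm => (hm₁ m hm).2⟩) m
  simp only [Set.mem_insert_iff, Set.mem_singleton_iff] at hi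
  rcases hi with rfl | rfl
  · -- DEPARTURE, `i = 0`: `D₀ = Φ'(0)`, `Φ(c) = ∫ G(y) p(s, z + c(0,e_b), y) dy`
    have hD := hasDerivAt_integral_mul_density N hp hs0 b z hG1 hGc
    -- bounds on `G`, `DG` for the segment identity
    obtain ⟨M₀, hM₀⟩ := hG.continuous.bounded_above_of_compact_support hGc
    have hgM : ∀ w, |G w| ≤ M₀ := fun w => by rw [← Real.norm_eq_abs]; exact hM₀ w
    obtain ⟨L₀, hL₀⟩ := (hG1.continuous_fderiv one_ne_zero).bounded_above_of_compact_support
      (hGc.fderiv (𝕜 := ℝ))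
    have hgL : ∀ w v, |fderiv ℝ G w v| ≤ max L₀ 0 * ‖v‖ := fun w v => by
      rw [← Real.norm_eq_abs]
      exact (fderiv ℝ G w).le_of_opNorm_le ((hL₀ w).trans (le_max_left _ _)) v
    -- continuity of `c ↦ A₁ A₂ (z + c(0,e_b))` at `0`
    have hcont : ContinuousAt (fun c : ℝ =>
        (∫ y, |G y| ^ r * p s (z + c • (((0 : Fin N → ℝ), Pi.single b 1) : PhaseSpace N)) y) ^
            (1 / r) *
          (K * (1 + C) ^ μ * Real.exp (ε *
            H (z + c • (((0 : Fin N → ℝ), Pi.single b 1) : PhaseSpace N))))) 0 := by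
      have hline : Continuous fun c : ℝ =>
          z + c • (((0 : Fin N → ℝ), Pi.single b 1) : PhaseSpace N) :=
        continuous_const.add (continuous_id.smul continuous_const)
      refine ContinuousAt.mul ?_ ?_
      · refine ContinuousAt.rpow_const ?_ (Or.inr (by positivity))
        exact (continuousAt_integral_rpow_abs_mul_density N hp hs0 hG.continuous hGc hr0
          _).comp hline.continuousAt
      · exact (continuous_const.mul ((continuous_const.mul
          ((pinnedChain_continuous_hamiltonian ω₂ lam β γ N).comp hline)).rexp)).continuousAt
    refine le_of_forall_pos_le_add fun η hη => ?_
    have hev := hcont.eventually (gt_mem_nhds (lt_add_of_pos_right _ hη))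
    simp only [zero_smul, add_zero] at hev
    obtain ⟨ρ, hρ, hball⟩ := Metric.eventually_nhds_iff.1 hev
    have hlip : ∀ᶠ c in 𝓝 (0 : ℝ),
        ‖(∫ y, G y * p s (z + c • (((0 : Fin N → ℝ), Pi.single b 1) : PhaseSpace N)) y) -
            ∫ y, G y * p s (z + (0 : ℝ) • (((0 : Fin N → ℝ), Pi.single b 1) : PhaseSpace N)) y‖ ≤
          ((∫ y, |G y| ^ r * p s z y) ^ (1 / r) * (K * (1 + C) ^ μ * Real.exp (ε * H z)) + η) *
            ‖c - 0‖ := by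
      refine Metric.eventually_nhds_iff.2 ⟨ρ, hρ, fun c hc => ?_⟩
      rw [zero_smul, add_zero, sub_zero, Real.norm_eq_abs, Real.norm_eq_abs,
        integral_mul_density_eq_integral_skelFlowMapAt hω hl hβ hγ N T δ hp hs0 hs1 0 _
          hG.continuous.measurable,
        integral_mul_density_eq_integral_skelFlowMapAt hω hl hβ hγ N T δ hp hs0 hs1 0 z
          hG.continuous.measurable,
        integral_comp_sub_eq_mul_integral_partialP hω hl hβ hγ hN0 hT (T_L := T + δ / 2)
          (T_R := T - δ / 2) (by linarith) (by linarith) (by linarith) (by linarith) hs' 0 b z c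
          hG1 hgM hgL, abs_mul]
      have hsegb : ∀ τ ∈ Set.uIoc (0 : ℝ) 1, ‖∫ wp, partialP b (fun z' =>
          G (skelFlowMapAt ω₂ lam β γ N (T + δ / 2) (T - δ / 2) s 0 z' (pairRem 0 wp)
            (pairSkel 0 wp)))
          (z + (τ * c) • (((0 : Fin N → ℝ), Pi.single b 1) : PhaseSpace N)) ∂wienerPair‖ ≤
          (∫ y, |G y| ^ r * p s z y) ^ (1 / r) * (K * (1 + C) ^ μ * Real.exp (ε * H z)) + η := by
        intro τ hτ
        rw [uIoc_of_le zero_le_one] at hτ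
        rw [Real.norm_eq_abs]
        refine (hDep _ 0).trans (hball ?_).le
        rw [dist_zero_right, Real.norm_eq_abs, abs_mul]
        have hc' : |c| < ρ := by rwa [dist_zero_right, Real.norm_eq_abs] at hc
        exact lt_of_le_of_lt
          (mul_le_of_le_one_left (abs_nonneg c) (by rw [abs_of_pos hτ.1]; exact hτ.2)) hc'
      have hI1 := intervalIntegral.norm_integral_le_of_norm_le_const hsegb
      rw [sub_zero, abs_one, mul_one, Real.norm_eq_abs] at hI1
      calc |c| * |∫ τ in (0 : ℝ)..1, ∫ wp, partialP b (fun z' => G (skelFlowMapAt ω₂ lam β γ N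
            (T + δ / 2) (T - δ / 2) s 0 z' (pairRem 0 wp) (pairSkel 0 wp)))
            (z + (τ * c) • (((0 : Fin N → ℝ), Pi.single b 1) : PhaseSpace N)) ∂wienerPair|
          ≤ |c| * ((∫ y, |G y| ^ r * p s z y) ^ (1 / r) *
              (K * (1 + C) ^ μ * Real.exp (ε * H z)) + η) :=
            mul_le_mul_of_nonneg_left hI1 (abs_nonneg c)
        _ = _ := by ring
    have hle := hD.le_of_lip' (add_nonneg (mul_nonneg (hA₁0 z) (hA₂0 z)) hη.le) hlip
    rwa [Real.norm_eq_abs] at hle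
  · -- ARRIVAL, `i = 2`: integrate by parts in `y_b`, pass to the path, apply W-3
    change |∫ y, G y * partialP b (p s z) y| ≤ _
    rw [integral_mul_partialP_density_eq_neg N hp hs0 z b hG1 hGc, abs_neg,
      integral_mul_density_eq_integral_skelFlowMapAt hω hl hβ hγ N T δ hp hs0 hs1 0 z
        (continuous_partialP_of_contDiff b hG1).measurable]
    exact hArr z 0

/-! ## 3. The headline junction and the junctions to S3 / K_fix -/

/-- ★★★ **(MC∞) ∧ (SW⁰₂) ⟹ (MD₂)** — the critic's `md₂_of_skeletonGramLimitInverseMoments_of_sw`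
(row 1202 (3)(a)): the order split of part U, the order-1 junction §2 and the order-2 junction of
part U. [folklore] -/
theorem densityScoreDualBound₂_of_skeletonGramLimitInverseMoments_of_sw
    (h₁ : SkeletonGramLimitInverseMoments) (h₂ : SkeletonWeightControl₂) :
    DensityScoreDualBound₂ :=
  densityScoreDualBound₂_of_orders (densityScoreDualBoundFirst_of_gram h₁ h₂.1)
    (densityScoreDualBoundSecond_of_gram h₁ h₂.2)

/-- ★★ **S3 ⟸ (Dˢ) ∧ (MC∞) ∧ (SW⁰₂)** (tree `kernelTemperatureLipschitz_of_scoreDual`).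
[cite: CuneoEckmannHairerReyBellet2018, Prop. 3.2] -/
theorem kernelTemperatureLipschitz_of_skeletonGramLimit_of_sw (hD : KernelTemperatureDuhamelSmooth)
    (h₁ : SkeletonGramLimitInverseMoments) (h₂ : SkeletonWeightControl₂) :
    KernelTemperatureLipschitz :=
  kernelTemperatureLipschitz_of_scoreDual hD
    (densityScoreDualBound₂_of_skeletonGramLimitInverseMoments_of_sw h₁ h₂)

/-- **Junction K_fix ⟸ A0 ∧ A2 ∧ (Dˢ) ∧ (MC∞) ∧ (SW⁰₂) ∧ A3p ∧ A4** (tree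
`snapshotKLUpperExpansion_of_atoms₆SD`). [cite: CuneoEckmannHairerReyBellet2018, Prop. 3.2] -/
theorem snapshotKLUpperExpansion_of_atoms₇SW (h0 : NessGibbsReweighting)
    (h2 : NessOddLogRatioBound) (hD : KernelTemperatureDuhamelSmooth)
    (h₁ : SkeletonGramLimitInverseMoments) (h₂ : SkeletonWeightControl₂)
    (h3p : NessFloorMeanValue) (h4 : NessLinearResponseL2) : SnapshotKLUpperExpansion :=
  snapshotKLUpperExpansion_of_atoms₆SD h0 h2 hD
    (densityScoreDualBound₂_of_skeletonGramLimitInverseMoments_of_sw h₁ h₂) h3p h4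

/-! ## 4. The hypothesis of (RW₁) is consumable: the trivial frame minorant `Λ := κ` -/

/-- **The trivial frame minorant**: for every level `m`, point `z`, pair `wp`, vector `a` and real
`κ`, `κ|a|² ≤ aᵀ(Γ_m(wp) + κ)a` (`Γ_m = skelGramPath … ⪰ 0`, tree
`dotProduct_skelGramPath_mulVec_nonneg`). [formal bookkeeping] -/
theorem const_frame_minorant {ω₂ lam β γ : ℝ} {N : ℕ} {T_L T_R s : ℝ} (m : ℕ) (z : PhaseSpace N)
    (κ : ℝ) (wp : WienerPair) (a : Fin N ⊕ Fin N → ℝ) :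
    κ * (a ⬝ᵥ a) ≤
      a ⬝ᵥ ((skelGramPath ω₂ lam β γ N T_L T_R s m z wp +
        κ • (1 : Matrix (Fin N ⊕ Fin N) (Fin N ⊕ Fin N) ℝ)) *ᵥ a) := by
  rw [dotProduct_add_smul_one_mulVec]
  exact le_add_of_nonneg_left (dotProduct_skelGramPath_mulVec_nonneg m z wp a)

/-- **Inverse moments of the trivial minorant**: for `κ > 0`, `q' > 0`, `ε' ≥ 0` and non-negative
parameters, `E[κ^{-q'}] = κ^{-q'} ≤ (κ⁻¹ e^{ε'H(z)})^{q'}` on the two-bath Wiener space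
(a probability space; `H ≥ 0`, Literature `pinnedChain_hamiltonian_nonneg`). [formal bookkeeping] -/
theorem lintegral_inv_const_rpow_le {ω₂ lam β γ : ℝ} (hω : 0 ≤ ω₂) (hl : 0 ≤ lam) (hβ : 0 ≤ β)
    (N : ℕ) (z : PhaseSpace N) {κ : ℝ} (hκ : 0 < κ) {q' ε' : ℝ} (hq' : 0 < q') (hε' : 0 ≤ ε') :
    ∫⁻ _wp, (ENNReal.ofReal κ)⁻¹ ^ q' ∂wienerPair ≤
      ENNReal.ofReal ((κ⁻¹ * Real.exp (ε' * (pinnedChain ω₂ lam β γ).hamiltonian N z)) ^ q') := by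
  rw [lintegral_const, measure_univ, mul_one, ← ENNReal.ofReal_inv_of_pos hκ,
    ENNReal.ofReal_rpow_of_nonneg (inv_nonneg.2 hκ.le) hq'.le]
  refine ENNReal.ofReal_le_ofReal (Real.rpow_le_rpow (inv_nonneg.2 hκ.le) ?_ hq'.le)
  exact le_mul_of_one_le_right (inv_nonneg.2 hκ.le)
    (Real.one_le_exp (mul_nonneg hε' (pinnedChain_hamiltonian_nonneg hω hl hβ γ N z)))

/-- ★ **(RW₁) at the trivial minorant — its hypothesis is consumable, its content is level-wise.**
(RW₁) ALONE gives, for every `κ > 0` and EVERY level `m`, the `q`-moment bounds of both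
regularised order-1 weights `w_{m,κ}`, `w'_{m,κ}` with the `κ`-DEPENDENT constant `K(1+κ⁻¹)^μ`
(feed `Λ := κ`, `C₁ := κ⁻¹`: `const_frame_minorant`, `lintegral_inv_const_rpow_le`).  So the
hypothesis shape of (RW₁) is met by at least one minorant (no vacuity), (RW₁) carries no Hörmander /
small-ball content, and the `κ`-UNIFORM constant produced by the junction
`densityScoreDualBoundFirst_of_gram` is located in h₁ = (MC∞) (critic rows 1202 (3)(c), 1212 (2)).
[formal bookkeeping] -/
theorem skelMoment_le_of_gramControlledWeightMoments_const (h₂ : GramControlledWeightMoments)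
    {ω₂ lam β γ : ℝ} (hω : 0 < ω₂) (hl : 0 < lam) (hβ : 0 < β) (hγ : 0 < γ) {T : ℝ} (hT : 0 < T)
    {N : ℕ} (hN : 2 ≤ N) {q ε : ℝ} (hq : 1 < q) (hε : 0 < ε) :
    ∃ (δ₀ K : ℝ) (μ : ℕ), 0 < δ₀ ∧ 0 ≤ K ∧ ∀ δ : ℝ, |δ| < δ₀ → ∀ s : ℝ, 1 / 2 ≤ s → s ≤ 1 →
      ∀ b : Fin N, (b = leftBath N hN ∨ b = rightBath N hN) → ∀ z : PhaseSpace N,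
        ∀ κ : ℝ, 0 < κ → ∀ m : ℕ,
          skelMoment m q (skelWeightArr ω₂ lam β γ N (T + δ / 2) (T - δ / 2) s m κ b z) ≤
              ENNReal.ofReal ((K * (1 + κ⁻¹) ^ μ *
                Real.exp (ε * (pinnedChain ω₂ lam β γ).hamiltonian N z)) ^ q) ∧
            skelMoment m q (skelWeightDep ω₂ lam β γ N (T + δ / 2) (T - δ / 2) s m κ b z) ≤
              ENNReal.ofReal ((K * (1 + κ⁻¹) ^ μ *
                Real.exp (ε * (pinnedChain ω₂ lam β γ).hamiltonian N z)) ^ q) := by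
  obtain ⟨q', ε', δ₀, K, μ, hq', hε', hδ₀, hK, hRW⟩ :=
    h₂ ω₂ lam β γ hω hl hβ hγ T hT N hN q ε hq hε
  exact ⟨δ₀, K, μ, hδ₀, hK, fun δ hδ s hs hs1 b hb z κ hκ m =>
    hRW κ⁻¹ (inv_nonneg.2 hκ.le) δ hδ s hs hs1 b hb z κ hκ m (fun _ => κ) measurable_const
      (fun wp a => const_frame_minorant m z κ wp a)
      (lintegral_inv_const_rpow_le hω.le hl.le hβ.le N z hκ hq' hε'.le)⟩

end Summit.AtomisticToContinuum.FouriersLaw.Theorems.ExtensiveSnapshotIrreversibility.EnergyWindow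

end
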